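import Literature.NumberTheory.Sieve.PolymathProductTestFunctions
import Literature.Analysis.Convolution.ConvolutionPowerDiscretization
import Mathlib.Probability.Moments.SubGaussian
import Mathlib.MeasureTheory.Integral.Pi
import Mathlib.MeasureTheory.Function.Floor
import HarnessLib

/-!
# Hoeffding-recentred lattice bounds for the product test functions

Topic `Literature/NumberTheory/Sieve`, namespace `Literature.NumberTheory.Sieve.MaynardTao` (companion of
`PolymathProductTestFunctions`, `PolymathProductLatticeBounds` and of
`Literature/Analysis/Convolution/ConvolutionPowerDiscretization.lean`).  Everything here is PROVED; standard axioms.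

The pure lattice sandwich rounds each of the `k` convolution factors down (or up) to the lattice `hℕ`; the total
rounding error `R = Σᵢ (tᵢ − h⌊tᵢ/h⌋) ∈ [0, kh)` is lost, which forces `h ≈ 10⁻⁶/k`-fine lattices.  Hoeffding's
inequality [cite: Hoeffding1963, Thm 2] for the `k` independent bounded rounding errors recovers all but
`λ = O(h√k)` of it outside an event of probability `exp(−2λ²/(k h²))`: with `e = E(t − h⌊t/h⌋)` the mean rounding
error of one factor (law `φ/m₀`),

  `∫_{R_k} ∏ φ(tᵢ) dt ≤ Σ_{m ≤ m⋆} (p^{∗k})_m + m₀^k · exp(−2λ²/(k h²))`   whenever `1 − (m⋆+1)h + λ ≤ k·e`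

(`setIntegral_simplex_prod_le_hoeffding`, and `setIntegral_cpow_le_hoeffding` for `∫_{(0,1]} φ^{⋆k}`), i.e.
`P(S_k ≤ 1) ≤ P(S⁻_k ≤ 1 − δ) + e^{−2λ²/(kh²)}` with `δ = k e − λ` — the denominator bound of a lattice certificate for
the Maynard functional of Polymath's product test function [cite: Polymath8b2014, §6, proof of Theorem 6.7] at a lattice
`k`-times coarser; and symmetrically, rounding UP and recentring by the mean upward error `h − e`, for an antitone
weight `0 ≤ Ψ ≤ B` with `Ψ(1) = 0` (the numerator `E Ψ(S_{k−1})`, `Ψ(w) = (∫₀^{1−w} g)²`):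

  `Σ_{m<M} Ψ((m+k)h − δ) (p^{∗k})_m − B m₀^k e^{−2λ²/(kh²)} ≤ ∫_{R_k} Ψ(Σtᵢ) ∏ φ(tᵢ) dt`   whenever `δ + λ ≤ k(h − e)`

(`sum_weight_dconvPow_le_setIntegral_simplex_hoeffding`, `sum_weight_dconvPow_le_setIntegral_cpow_hoeffding`).  The proof is Hoeffding's: split the simplex integral over the lattice boxes `B_J`; boxes with
`h|J| ≤ m⋆h` contribute at most `∏ p_{Jᵢ}`; on the others `Σ tᵢ ≤ 1` forces `R < 1 − (m⋆+1)h`, and the exponential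
Markov bound `𝟙_{R<δ₀} ≤ e^{s(δ₀−R)}` factorises over the coordinates into the `k`-th power of the tilted mass
`∫ e^{−s(t−h⌊t/h⌋)} φ(t) dt ≤ m₀ e^{−se+s²h²/8}` (Hoeffding's lemma, from Mathlib's `hasSubgaussianMGF_of_mem_Icc`);
`s = 4λ/(kh²)` optimises.
-/

noncomputable section

open MeasureTheory Set Finset Real Literature.Analysis.Convolution ProbabilityTheory
open scoped BigOperators NNReal ENNReal

namespace Literature.NumberTheory.Sieve

namespace MaynardTao

/-! ### Lattice cells `[jh,(j+1)h)`, rounding error, and the cell decomposition of a function -/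

section Cells

variable {φ : ℝ → ℝ} {h T : ℝ} {Jc : ℕ}

/-- The rounding error `r_h(x) = x − h⌊x/h⌋ ∈ [0,h)` of the rounding down to the lattice `hℤ`.
[cite: KlugmanPanjerWillmot2004, §6.6.5.1 (method of rounding)] -/
def roundErr (h x : ℝ) : ℝ := x - h * (⌊x / h⌋ : ℝ)

/-- `0 ≤ r_h(x) < h` for `h > 0`. [cite: KlugmanPanjerWillmot2004, §6.6.5.1 (method of rounding)] -/
theorem roundErr_mem_Ico (hh : 0 < h) (x : ℝ) : roundErr h x ∈ Ico 0 h := by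
  have h1 : (⌊x / h⌋ : ℝ) ≤ x / h := Int.floor_le _
  have h2 : x / h < (⌊x / h⌋ : ℝ) + 1 := Int.lt_floor_add_one _
  rw [roundErr, Set.mem_Ico]
  constructor
  · have : h * (⌊x / h⌋ : ℝ) ≤ h * (x / h) := mul_le_mul_of_nonneg_left h1 hh.le
    rw [mul_div_cancel₀ _ hh.ne'] at this
    linarith
  · have : h * (x / h) < h * ((⌊x / h⌋ : ℝ) + 1) := mul_lt_mul_of_pos_left h2 hh
    rw [mul_div_cancel₀ _ hh.ne'] at this
    linarith

/-- The rounding error is measurable. [cite: KlugmanPanjerWillmot2004, §6.6.5.1 (method of rounding)] -/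
theorem measurable_roundErr (h : ℝ) : Measurable (roundErr h) := by
  unfold roundErr
  refine measurable_id.sub (measurable_const.mul ?_)
  exact measurable_from_top.comp (Int.measurable_floor.comp (measurable_id.div_const h))

/-- On the cell `[jh,(j+1)h)` the rounding error is `x − jh`. [cite: KlugmanPanjerWillmot2004, §6.6.5.1 (method of rounding)] -/
theorem roundErr_of_mem_Ico (hh : 0 < h) {j : ℕ} {x : ℝ} (hx : x ∈ Ico ((j : ℝ) * h) (((j : ℝ) + 1) * h)) :
    roundErr h x = x - (j : ℝ) * h := by
  have hfl : ⌊x / h⌋ = (j : ℤ) := by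
    rw [Int.floor_eq_iff]
    constructor
    · rw [Int.cast_natCast, le_div_iff₀ hh]; exact hx.1
    · rw [Int.cast_natCast, div_lt_iff₀ hh]; linarith [hx.2]
  rw [roundErr, hfl]
  push_cast
  ring

/-- Membership in a lattice cell is decided by the floor: for `x ≥ 0`, `x ∈ [jh,(j+1)h) ↔ ⌊x/h⌋ = j`.
[cite: KlugmanPanjerWillmot2004, §6.6.5.1 (method of rounding)] -/
theorem mem_Ico_iff_floor (hh : 0 < h) {j : ℕ} {x : ℝ} :
    x ∈ Ico ((j : ℝ) * h) (((j : ℝ) + 1) * h) ↔ ⌊x / h⌋ = (j : ℤ) := by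
  rw [Int.floor_eq_iff, Int.cast_natCast, le_div_iff₀ hh, div_lt_iff₀ hh, Set.mem_Ico]

/-- **Cell decomposition of one factor**: for `x ≥ 0`, a function `ψ` vanishing on `[J_c h, ∞)` is the sum of its
restrictions to the cells `[jh,(j+1)h)`, `j < J_c`. [cite: KlugmanPanjerWillmot2004, §6.6.5.1 (method of rounding)] -/
theorem sum_indicator_Ico_eq {ψ : ℝ → ℝ} (hh : 0 < h) (hψ : ∀ x, (Jc : ℝ) * h ≤ x → ψ x = 0) {x : ℝ}
    (hx : 0 ≤ x) :
    ∑ j ∈ range Jc, (Ico ((j : ℝ) * h) (((j : ℝ) + 1) * h)).indicator ψ x = ψ x := by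
  by_cases hxJ : x < (Jc : ℝ) * h
  · -- the unique cell containing `x` is `j₀ = ⌊x/h⌋`
    have hfl0 : 0 ≤ ⌊x / h⌋ := Int.floor_nonneg.2 (div_nonneg hx hh.le)
    obtain ⟨j₀, hj₀⟩ : ∃ j₀ : ℕ, (⌊x / h⌋ : ℤ) = j₀ := ⟨(⌊x / h⌋).toNat, (Int.toNat_of_nonneg hfl0).symm⟩
    have hmem : x ∈ Ico ((j₀ : ℝ) * h) (((j₀ : ℝ) + 1) * h) := (mem_Ico_iff_floor hh).2 hj₀
    have hj₀J : j₀ < Jc := by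
      have h1 : (j₀ : ℝ) * h ≤ x := hmem.1
      have h2 : (j₀ : ℝ) < Jc := by
        by_contra hcon
        have : (Jc : ℝ) ≤ j₀ := not_lt.1 hcon
        nlinarith
      exact_mod_cast h2
    rw [Finset.sum_eq_single j₀]
    · rw [indicator_of_mem hmem]
    · intro j _ hj
      rw [indicator_of_notMem]
      intro hxj
      exact hj (by have := (mem_Ico_iff_floor hh).1 hxj; rw [hj₀] at this; exact_mod_cast this.symm)
    · intro hj₀'
      exact absurd (Finset.mem_range.2 hj₀J) hj₀'
  · rw [hψ x (not_lt.1 hxJ)]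
    refine Finset.sum_eq_zero fun j hj => ?_
    rw [indicator_of_notMem]
    intro hxj
    have hj' : (j : ℝ) + 1 ≤ Jc := by exact_mod_cast Finset.mem_range.1 hj
    have : x < (Jc : ℝ) * h := lt_of_lt_of_le hxj.2 (by nlinarith)
    exact hxJ this

/-- The cell masses over half-open cells `[jh,(j+1)h)` agree with `cellMass` (cells `(jh,(j+1)h]`).
[cite: KlugmanPanjerWillmot2004, §6.6.5.1 (method of rounding)] -/
theorem integral_indicator_Ico_eq_cellMass (φ : ℝ → ℝ) (h : ℝ) (j : ℕ) :
    ∫ x, (Ico ((j : ℝ) * h) (((j : ℝ) + 1) * h)).indicator φ x = cellMass φ h j := by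
  rw [integral_indicator measurableSet_Ico, cellMass]
  exact setIntegral_congr_set (Ico_ae_eq_Icc.trans Ioc_ae_eq_Icc.symm)

end Cells

/-! ### The tilted one-factor mass and Hoeffding's lemma -/

section Tilt

variable {φ : ℝ → ℝ} {h T : ℝ}

/-- The non-negative part-line restriction `φ₊ = 𝟙_{[0,∞)} φ` (the law of one factor lives on `[0,∞)`).
[cite: Polymath8b2014, §6, proof of Theorem 6.7 (g extended by zero)] -/
def posPart' (φ : ℝ → ℝ) : ℝ → ℝ := (Ici (0:ℝ)).indicator φ

/-- **Hoeffding's lemma for the rounding error**, analytic form: for `φ ≥ 0` locally bounded, vanishing beyond `T`,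
with mass `m₀ = ∫_{[0,∞)} φ > 0` and first rounding moment `E₁ = ∫_{[0,∞)} r_h φ`, and every real `s`,
`∫_{[0,∞)} e^{s (r_h(x) − E₁/m₀)} φ(x) dx ≤ m₀ e^{s² h²/8}` (`r_h ∈ [0,h]`). [cite: Hoeffding1963, Thm 2 (proof, Lemma: E e^{s(X−EX)} ≤ e^{s²(b−a)²/8})] -/
theorem integral_exp_mul_roundErr_le (hφ : LocBdd φ) (hφ0 : ∀ x, 0 ≤ φ x) (hT : ∀ x, T < x → φ x = 0)
    (hh : 0 < h) {m₀ : ℝ} (hm₀ : m₀ = ∫ x in Ici 0, φ x) (hm₀pos : 0 < m₀) (s : ℝ) :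
    ∫ x in Ici 0, Real.exp (s * (roundErr h x - (∫ x in Ici 0, roundErr h x * φ x) / m₀)) * φ x ≤
      m₀ * Real.exp (s ^ 2 * h ^ 2 / 8) := by
  -- the probability density `d = φ₊/m₀` and the probability measure `ν = d · Lebesgue`
  set φp : ℝ → ℝ := posPart' φ with hφp
  have hφp0 : ∀ x, 0 ≤ φp x := fun x => by
    simp only [hφp, posPart']; exact Set.indicator_nonneg (fun y _ => hφ0 y) x
  have hφpm : Measurable φp := hφ.measurable.indicator measurableSet_Ici
  -- `φ₊` is integrable: bounded with support in `[0,T]`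
  have hφp_supp : ∀ x, x ∉ Icc 0 T → φp x = 0 := by
    intro x hx
    simp only [hφp, posPart', Set.indicator]
    split_ifs with h0
    · exact hT x (by
        by_contra hle
        exact hx ⟨h0, not_lt.1 hle⟩)
    · rfl
  have hφp_int : Integrable φp := by
    have h1 : φp = (Icc 0 T).indicator φp := by
      funext x; by_cases hx : x ∈ Icc 0 T
      · rw [indicator_of_mem hx]
      · rw [indicator_of_notMem hx, hφp_supp x hx]
    rw [h1, integrable_indicator_iff measurableSet_Icc]
    have hIoc : IntegrableOn φp (Ioc 0 T) := (hφ.indicator measurableSet_Ici).integrableOn_Ioc 0 T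
    rw [integrableOn_Icc_iff_integrableOn_Ioc]
    exact hIoc
  have hint_eq : ∀ g : ℝ → ℝ, ∫ x in Ici 0, g x * φ x = ∫ x, g x * φp x := by
    intro g
    rw [← integral_indicator measurableSet_Ici]
    congr 1; funext x
    simp only [hφp, posPart', Set.indicator]
    split_ifs <;> simp
  set d : ℝ → ℝ≥0 := fun x => Real.toNNReal (φp x / m₀) with hd
  have hdm : Measurable d := (hφpm.div_const m₀).real_toNNReal
  have hdcoe : ∀ x, ((d x : ℝ≥0) : ℝ) = φp x / m₀ := fun x =>
    Real.coe_toNNReal _ (div_nonneg (hφp0 x) hm₀pos.le)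
  set ν : Measure ℝ := volume.withDensity fun x => (d x : ℝ≥0∞) with hν
  have hν_int : ∀ g : ℝ → ℝ, ∫ x, g x ∂ν = ∫ x, (φp x / m₀) * g x := by
    intro g
    rw [hν, integral_withDensity_eq_integral_smul hdm]
    congr 1; funext x
    rw [NNReal.smul_def, hdcoe, smul_eq_mul]
  haveI : IsProbabilityMeasure ν := by
    constructor
    rw [hν, withDensity_apply _ MeasurableSet.univ, Measure.restrict_univ]
    have hdint : Integrable (fun x => ((d x : ℝ≥0) : ℝ)) := by
      have : (fun x => ((d x : ℝ≥0) : ℝ)) = fun x => φp x / m₀ := funext hdcoe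
      rw [this]; exact hφp_int.div_const m₀
    have hφp_total : ∫ x, φp x = m₀ := by
      rw [hm₀, hφp, posPart', integral_indicator measurableSet_Ici]
    have h2 : ∫ x, ((d x : ℝ≥0) : ℝ) = 1 := by
      simp_rw [hdcoe]
      rw [integral_div, hφp_total, div_self hm₀pos.ne']
    rw [lintegral_coe_eq_integral d hdint, h2, ENNReal.ofReal_one]
  -- Hoeffding's lemma for `R = r_h` on `(ℝ, ν)`: `R ∈ [0,h]` surely
  have hR_meas : AEMeasurable (roundErr h) ν := (measurable_roundErr h).aemeasurable
  have hR_mem : ∀ᵐ ω ∂ν, roundErr h ω ∈ Icc 0 h :=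
    ae_of_all _ fun x => Ico_subset_Icc_self (roundErr_mem_Ico hh x)
  have hsg := hasSubgaussianMGF_of_mem_Icc hR_meas hR_mem
  have hmgf := hsg.mgf_le s
  -- identify the mean `ν[R] = E₁/m₀`
  set E : ℝ := (∫ x in Ici 0, roundErr h x * φ x) / m₀ with hE
  have hνR : ∫ ω, roundErr h ω ∂ν = E := by
    rw [hν_int, hE, hint_eq, div_eq_inv_mul, ← integral_const_mul]
    congr 1; funext x; ring
  have hmgf' : mgf (fun ω => roundErr h ω - ∫ ω, roundErr h ω ∂ν) ν s =
      (∫ x, Real.exp (s * (roundErr h x - E)) * φp x) / m₀ := by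
    rw [ProbabilityTheory.mgf, hν_int, hνR, div_eq_inv_mul, ← integral_const_mul]
    congr 1; funext x; ring
  rw [hmgf'] at hmgf
  have hc : (((‖h - 0‖₊ / 2) ^ 2 : ℝ≥0) : ℝ) = h ^ 2 / 4 := by
    rw [sub_zero]; push_cast; rw [Real.norm_of_nonneg hh.le]; ring
  rw [hint_eq]
  have h3 := (div_le_iff₀ hm₀pos).1 hmgf
  rw [hc] at h3
  calc ∫ x, Real.exp (s * (roundErr h x - E)) * φp x
      ≤ Real.exp (h ^ 2 / 4 * s ^ 2 / 2) * m₀ := h3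
    _ = m₀ * Real.exp (s ^ 2 * h ^ 2 / 8) := by rw [mul_comm]; congr 1; congr 1; ring

end Tilt

/-! ### Cell functions and box terms on the product space -/

section Boxes

variable {φ : ℝ → ℝ} {h T : ℝ} {Jc : ℕ}

/-- The restriction of `φ` to the cell `[jh,(j+1)h)`. [cite: KlugmanPanjerWillmot2004, §6.6.5.1 (method of rounding)] -/
def cellFn (φ : ℝ → ℝ) (h : ℝ) (j : ℕ) : ℝ → ℝ := (Ico ((j : ℝ) * h) (((j : ℝ) + 1) * h)).indicator φ

/-- Cell functions of a non-negative function are non-negative. [cite: KlugmanPanjerWillmot2004, §6.6.5.1 (method of rounding)] -/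
theorem cellFn_nonneg (hφ0 : ∀ x, 0 ≤ φ x) (h : ℝ) (j : ℕ) (x : ℝ) : 0 ≤ cellFn φ h j x :=
  Set.indicator_nonneg (fun y _ => hφ0 y) x

/-- Cell functions of a measurable function are measurable. [cite: KlugmanPanjerWillmot2004, §6.6.5.1 (method of rounding)] -/
theorem measurable_cellFn (hφ : LocBdd φ) (h : ℝ) (j : ℕ) : Measurable (cellFn φ h j) :=
  hφ.measurable.indicator measurableSet_Ico

/-- Cell functions of a locally bounded function are integrable. [cite: KlugmanPanjerWillmot2004, §6.6.5.1 (method of rounding)] -/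
theorem integrable_cellFn (hφ : LocBdd φ) (h : ℝ) (j : ℕ) : Integrable (cellFn φ h j) := by
  rw [cellFn, integrable_indicator_iff measurableSet_Ico]
  have hIcc : IntegrableOn φ (Icc ((j : ℝ) * h) (((j : ℝ) + 1) * h)) := by
    rw [integrableOn_Icc_iff_integrableOn_Ioc]
    exact hφ.integrableOn_Ioc _ _
  exact hIcc.mono_set Ico_subset_Icc_self

/-- `∫ cellFn φ h j = p_j`. [cite: KlugmanPanjerWillmot2004, §6.6.5.1 (method of rounding)] -/
theorem integral_cellFn (φ : ℝ → ℝ) (h : ℝ) (j : ℕ) : ∫ x, cellFn φ h j x = cellMass φ h j :=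
  integral_indicator_Ico_eq_cellMass φ h j

/-- A bounded measurable factor times an integrable function is integrable (the tilted cell functions).
[cite: Hoeffding1963, Thm 2 (proof)] -/
theorem integrable_cellFn_mul_exp (hφ : LocBdd φ) (hh : 0 < h) (s : ℝ) (j : ℕ) :
    Integrable (fun x => cellFn φ h j x * Real.exp (-s * roundErr h x)) := by
  have hbm : Measurable fun x => Real.exp (-s * roundErr h x) :=
    ((measurable_roundErr h).const_mul (-s)).exp
  have hbdd : ∀ x, ‖Real.exp (-s * roundErr h x)‖ ≤ Real.exp (|s| * h) := by
    intro x
    rw [Real.norm_eq_abs, abs_of_pos (Real.exp_pos _)]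
    refine Real.exp_le_exp.2 ?_
    have hr := roundErr_mem_Ico hh x
    calc -s * roundErr h x ≤ |(-s) * roundErr h x| := le_abs_self _
      _ = |s| * roundErr h x := by rw [abs_mul, abs_neg, abs_of_nonneg hr.1]
      _ ≤ |s| * h := mul_le_mul_of_nonneg_left hr.2.le (abs_nonneg s)
  have := (integrable_cellFn hφ h j).bdd_mul hbm.aestronglyMeasurable (ae_of_all _ hbdd)
  simpa only [mul_comm] using this

variable {n : ℕ}

/-- **Box decomposition** of the product density on the non-negative orthant: for `t ≥ 0` coordinatewise and `φ`
vanishing beyond `T < J_c h`, `∏ φ(tᵢ) = Σ_{J ∈ [0,J_c)^n} ∏ (𝟙_{[Jᵢh,(Jᵢ+1)h)} φ)(tᵢ)`. [cite: Hoeffding1963, Thm 2 (proof)] -/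
theorem prod_eq_sum_box (hh : 0 < h) (hT : ∀ x, T < x → φ x = 0) (hJc : T < (Jc : ℝ) * h)
    {t : Fin n → ℝ} (ht : ∀ i, 0 ≤ t i) :
    ∏ i, φ (t i) = ∑ J ∈ Fintype.piFinset (fun _ : Fin n => range Jc), ∏ i, cellFn φ h (J i) (t i) := by
  have hvan : ∀ x, (Jc : ℝ) * h ≤ x → φ x = 0 := fun x hx => hT x (lt_of_lt_of_le hJc hx)
  rw [← Finset.prod_univ_sum (fun _ : Fin n => range Jc) (fun i j => cellFn φ h j (t i))]
  refine Finset.prod_congr rfl fun i _ => ?_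
  exact (sum_indicator_Ico_eq hh hvan (ht i)).symm

/-- Box terms are integrable on the product space. [cite: Hoeffding1963, Thm 2 (proof)] -/
theorem integrable_boxTerm (hφ : LocBdd φ) (h : ℝ) (J : Fin n → ℕ) :
    Integrable (fun t : Fin n → ℝ => ∏ i, cellFn φ h (J i) (t i)) := by
  have := Integrable.fintype_prod (μ := fun _ : Fin n => (volume : Measure ℝ))
    (f := fun i => cellFn φ h (J i)) (fun i => integrable_cellFn hφ h (J i))
  simpa only [volume_pi] using this

/-- The integral of a box term is the product of the cell masses. [cite: Hoeffding1963, Thm 2 (proof)] -/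
theorem integral_boxTerm (φ : ℝ → ℝ) (h : ℝ) (J : Fin n → ℕ) :
    ∫ t : Fin n → ℝ, ∏ i, cellFn φ h (J i) (t i) = ∏ i, cellMass φ h (J i) := by
  rw [integral_fintype_prod_volume_eq_prod (fun i => cellFn φ h (J i))]
  simp only [integral_cellFn]

/-- Tilted box terms are integrable. [cite: Hoeffding1963, Thm 2 (proof)] -/
theorem integrable_boxTerm_tilt (hφ : LocBdd φ) (hh : 0 < h) (s : ℝ) (J : Fin n → ℕ) :
    Integrable (fun t : Fin n → ℝ => ∏ i, (cellFn φ h (J i) (t i) * Real.exp (-s * roundErr h (t i)))) := by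
  have := Integrable.fintype_prod (μ := fun _ : Fin n => (volume : Measure ℝ))
    (f := fun i => fun x => cellFn φ h (J i) x * Real.exp (-s * roundErr h x))
    (fun i => integrable_cellFn_mul_exp hφ hh s (J i))
  simpa only [volume_pi] using this

/-- The integral of a tilted box term is the product of the tilted cell masses. [cite: Hoeffding1963, Thm 2 (proof)] -/
theorem integral_boxTerm_tilt (φ : ℝ → ℝ) (h s : ℝ) (J : Fin n → ℕ) :
    ∫ t : Fin n → ℝ, ∏ i, (cellFn φ h (J i) (t i) * Real.exp (-s * roundErr h (t i))) =
      ∏ i, ∫ x, cellFn φ h (J i) x * Real.exp (-s * roundErr h x) :=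
  integral_fintype_prod_volume_eq_prod (fun i => fun x => cellFn φ h (J i) x * Real.exp (-s * roundErr h x))

/-- **Exponential Markov bound on a far box**: on the simplex `Σ tᵢ ≤ 1`, for a box `J` with `h|J| ≥ (m⋆+1)h`
and `s ≥ 0`, `∏ (𝟙_{C_{Jᵢ}}φ)(tᵢ) ≤ e^{s(1−(m⋆+1)h)} ∏ (𝟙_{C_{Jᵢ}}φ)(tᵢ) e^{−s r_h(tᵢ)}` (the total rounding error is
`Σ tᵢ − h|J| ≤ 1 − (m⋆+1)h` there). [cite: Hoeffding1963, Thm 2 (proof)] -/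
theorem boxTerm_le_exp_mul (hφ0 : ∀ x, 0 ≤ φ x) (hh : 0 < h) {s : ℝ} (hs : 0 ≤ s) {mstar : ℕ}
    {J : Fin n → ℕ} (hJ : mstar + 1 ≤ ∑ i, J i) {t : Fin n → ℝ} (ht : ∑ i, t i ≤ 1) :
    ∏ i, cellFn φ h (J i) (t i) ≤
      Real.exp (s * (1 - ((mstar : ℝ) + 1) * h)) *
        ∏ i, (cellFn φ h (J i) (t i) * Real.exp (-s * roundErr h (t i))) := by
  have hG0 : 0 ≤ ∏ i, cellFn φ h (J i) (t i) := Finset.prod_nonneg fun i _ => cellFn_nonneg hφ0 h _ _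
  by_cases hzero : ∏ i, cellFn φ h (J i) (t i) = 0
  · rw [Finset.prod_mul_distrib, hzero, zero_mul, mul_zero]
  -- all coordinates lie in their cells
  have hmem : ∀ i, t i ∈ Ico ((J i : ℝ) * h) (((J i : ℝ) + 1) * h) := by
    intro i
    by_contra hni
    apply hzero
    exact Finset.prod_eq_zero (Finset.mem_univ i) (by rw [cellFn, indicator_of_notMem hni])
  have hr : ∀ i, roundErr h (t i) = t i - (J i : ℝ) * h := fun i => roundErr_of_mem_Ico hh (hmem i)
  have hsumr : ∑ i, roundErr h (t i) = ∑ i, t i - (∑ i, J i : ℕ) * h := by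
    simp_rw [hr]
    rw [Finset.sum_sub_distrib, Nat.cast_sum, Finset.sum_mul]
  have hJ' : ((mstar : ℝ) + 1) * h ≤ ((∑ i, J i : ℕ) : ℝ) * h := by
    refine mul_le_mul_of_nonneg_right ?_ hh.le
    exact_mod_cast hJ
  have hexp : 1 ≤ Real.exp (s * (1 - ((mstar : ℝ) + 1) * h)) * Real.exp (∑ i, (-s * roundErr h (t i))) := by
    rw [← Real.exp_add]
    refine Real.one_le_exp ?_
    have : ∑ i, (-s * roundErr h (t i)) = -s * ∑ i, roundErr h (t i) := by rw [Finset.mul_sum]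
    rw [this, hsumr]
    nlinarith
  calc ∏ i, cellFn φ h (J i) (t i)
      = (∏ i, cellFn φ h (J i) (t i)) * 1 := (mul_one _).symm
    _ ≤ (∏ i, cellFn φ h (J i) (t i)) *
          (Real.exp (s * (1 - ((mstar : ℝ) + 1) * h)) * Real.exp (∑ i, (-s * roundErr h (t i)))) :=
        mul_le_mul_of_nonneg_left hexp hG0
    _ = Real.exp (s * (1 - ((mstar : ℝ) + 1) * h)) *
          ∏ i, (cellFn φ h (J i) (t i) * Real.exp (-s * roundErr h (t i))) := by
        rw [Finset.prod_mul_distrib, Real.exp_sum]; ring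

/-- **The box sum of cell masses is dominated by the discrete convolution power**:
`Σ_{J ∈ [0,J_c)^n, |J| = m} ∏ p_{Jᵢ} ≤ (p^{∗n})_m` for `p ≥ 0` (equality if `p` vanishes beyond `J_c`; the coefficient of
`X^m` in `(Σ p_j X^j)^n`, [cite: GathenGerhard2013ModernComputerAlgebra, §2.3 (4)]). -/
theorem sum_box_fiber_le_dconvPow {p : ℕ → ℝ} (hp : ∀ j, 0 ≤ p j) (n Jc m : ℕ) :
    ∑ J ∈ (Fintype.piFinset (fun _ : Fin n => range Jc)).filter (fun J => ∑ i, J i = m), ∏ i, p (J i) ≤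
      dconvPow p n m := by
  classical
  set S := (Fintype.piFinset (fun _ : Fin n => range Jc)).filter (fun J => ∑ i, J i = m) with hS
  have hpow : (PowerSeries.mk p) ^ n = ∏ _i : Fin n, PowerSeries.mk p := by
    rw [Finset.prod_const, Finset.card_univ, Fintype.card_fin]
  rw [dconvPow, hpow, PowerSeries.coeff_prod]
  simp only [PowerSeries.coeff_mk]
  set e : (Fin n → ℕ) → (Fin n →₀ ℕ) := fun J => Finsupp.equivFunOnFinite.symm J with he
  have hinj : Set.InjOn e S := fun a _ b _ hab => Finsupp.equivFunOnFinite.symm.injective hab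
  have h1 : ∑ J ∈ S, ∏ i, p (J i) = ∑ l ∈ S.image e, ∏ i, p (l i) := by
    rw [Finset.sum_image hinj]
    rfl
  rw [h1]
  refine Finset.sum_le_sum_of_subset_of_nonneg ?_ fun l _ _ => Finset.prod_nonneg fun i _ => hp _
  intro l hl
  obtain ⟨J, hJ, rfl⟩ := Finset.mem_image.1 hl
  rw [hS, Finset.mem_filter] at hJ
  rw [Finset.mem_finsuppAntidiag]
  refine ⟨?_, fun i _ => Finset.mem_univ i⟩
  simpa [he] using hJ.2

end Boxes

/-! ### The Hoeffding-recentred denominator bound -/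

section Main

variable {φ : ℝ → ℝ} {h T : ℝ} {Jc n : ℕ}

/-- The tilted total mass splits over the cells: `Σ_{j<J_c} ∫ 𝟙_{C_j}φ e^{−sr_h} = ∫_{[0,∞)} e^{−sr_h} φ`.
[cite: Hoeffding1963, Thm 2 (proof)] -/
theorem sum_integral_cellFn_mul_exp (hφ : LocBdd φ) (hh : 0 < h) (hT : ∀ x, T < x → φ x = 0)
    (hJc : T < (Jc : ℝ) * h) (s : ℝ) :
    ∑ j ∈ range Jc, ∫ x, cellFn φ h j x * Real.exp (-s * roundErr h x) =
      ∫ x in Ici 0, Real.exp (-s * roundErr h x) * φ x := by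
  have hvan : ∀ x, (Jc : ℝ) * h ≤ x → φ x = 0 := fun x hx => hT x (lt_of_lt_of_le hJc hx)
  rw [← integral_finsetSum _ fun j _ => integrable_cellFn_mul_exp hφ hh s j, ← integral_indicator measurableSet_Ici]
  congr 1
  funext x
  rw [← Finset.sum_mul]
  by_cases hx : 0 ≤ x
  · rw [indicator_of_mem (show x ∈ Ici (0:ℝ) from hx)]
    simp only [cellFn]
    rw [sum_indicator_Ico_eq hh hvan hx, mul_comm]
  · rw [indicator_of_notMem (show x ∉ Ici (0:ℝ) from hx)]
    have : ∀ j ∈ range Jc, cellFn φ h j x = 0 := by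
      intro j _
      rw [cellFn, indicator_of_notMem]
      intro hxj
      exact hx (le_trans (by positivity) hxj.1)
    rw [Finset.sum_eq_zero this, zero_mul]

/-- **Hoeffding-recentred upper lattice bound for the simplex integral of a product density**: for `φ ≥ 0` locally
bounded vanishing beyond `T`, span `h > 0` with `T < J_c h`, `n ≥ 1` factors, mass `m₀ = ∫_{[0,∞)} φ > 0` and mean rounding
error `e = (∫_{[0,∞)} r_h φ)/m₀`, every `m⋆` and `λ ≥ 0` with `1 − (m⋆+1)h + λ ≤ n e` satisfy
`∫_{R_n} ∏ φ(tᵢ) ≤ Σ_{m ≤ m⋆} (p^{∗n})_m + m₀^n e^{−2λ²/(n h²)}` (`p_j = ∫_{(jh,(j+1)h]} φ`), i.e.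
`P(S_n ≤ 1) ≤ P(S⁻_n ≤ m⋆h) + e^{−2λ²/(nh²)}`. [cite: Hoeffding1963, Thm 2] -/
theorem setIntegral_simplex_prod_le_hoeffding (hφ : LocBdd φ) (hφ0 : ∀ x, 0 ≤ φ x)
    (hT : ∀ x, T < x → φ x = 0) (hh : 0 < h) (hJc : T < (Jc : ℝ) * h) (hn : 1 ≤ n) (mstar : ℕ)
    {lam : ℝ} (hlam : 0 ≤ lam) {m₀ : ℝ} (hm₀ : m₀ = ∫ x in Ici 0, φ x) (hm₀pos : 0 < m₀)
    (hcond : (1 - ((mstar : ℝ) + 1) * h) + lam ≤ n * ((∫ x in Ici 0, roundErr h x * φ x) / m₀)) :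
    ∫ t in maynardSimplex n, ∏ i, φ (t i) ≤
      ∑ m ∈ range (mstar + 1), dconvPow (cellMass φ h) n m +
        m₀ ^ n * Real.exp (-2 * lam ^ 2 / (n * h ^ 2)) := by
  classical
  set B := Fintype.piFinset (fun _ : Fin n => range Jc) with hB
  set p := cellMass φ h with hp
  have hp0 : ∀ j, 0 ≤ p j := cellMass_nonneg hφ0 h
  set δ₀ : ℝ := 1 - ((mstar : ℝ) + 1) * h with hδ₀
  set E : ℝ := (∫ x in Ici 0, roundErr h x * φ x) / m₀ with hE
  set s : ℝ := 4 * lam / (n * h ^ 2) with hs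
  have hn0 : (0:ℝ) < n := by exact_mod_cast hn
  have hs0 : 0 ≤ s := by rw [hs]; positivity
  -- Step A/B: decompose the integrand over the boxes and integrate termwise
  have hdecomp : ∫ t in maynardSimplex n, ∏ i, φ (t i) =
      ∑ J ∈ B, ∫ t in maynardSimplex n, ∏ i, cellFn φ h (J i) (t i) := by
    rw [← integral_finsetSum _ fun J _ => (integrable_boxTerm hφ h J).integrableOn]
    refine setIntegral_congr_fun (measurableSet_maynardSimplex n) fun t ht => ?_
    exact prod_eq_sum_box hh hT hJc ht.1
  rw [hdecomp, ← Finset.sum_filter_add_sum_filter_not B (fun J => ∑ i, J i ≤ mstar)]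
  refine add_le_add ?_ ?_
  · -- Group 1: near boxes, `∫_{R_n} ≤ ∫ = ∏ p_{Jᵢ}`, then the box sum is below the convolution power
    calc ∑ J ∈ B.filter (fun J => ∑ i, J i ≤ mstar), ∫ t in maynardSimplex n, ∏ i, cellFn φ h (J i) (t i)
        ≤ ∑ J ∈ B.filter (fun J => ∑ i, J i ≤ mstar), ∏ i, p (J i) := by
          refine Finset.sum_le_sum fun J _ => ?_
          rw [← integral_boxTerm φ h J]
          exact setIntegral_le_integral (integrable_boxTerm hφ h J)
            (Filter.Eventually.of_forall fun t => Finset.prod_nonneg fun i _ => cellFn_nonneg hφ0 h _ _)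
      _ = ∑ m ∈ range (mstar + 1), ∑ J ∈ (B.filter (fun J => ∑ i, J i ≤ mstar)).filter
            (fun J => ∑ i, J i = m), ∏ i, p (J i) := by
          rw [Finset.sum_fiberwise_of_maps_to]
          intro J hJ
          rw [Finset.mem_filter] at hJ
          exact Finset.mem_range.2 (Nat.lt_succ_of_le hJ.2)
      _ ≤ ∑ m ∈ range (mstar + 1), dconvPow p n m := by
          refine Finset.sum_le_sum fun m hm => ?_
          have hsub : (B.filter (fun J => ∑ i, J i ≤ mstar)).filter (fun J => ∑ i, J i = m) ⊆
              B.filter (fun J => ∑ i, J i = m) := by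
            intro J hJ
            simp only [Finset.mem_filter] at hJ ⊢
            exact ⟨hJ.1.1, hJ.2⟩
          exact (Finset.sum_le_sum_of_subset_of_nonneg hsub fun J _ _ =>
            Finset.prod_nonneg fun i _ => hp0 _).trans (sum_box_fiber_le_dconvPow hp0 n Jc m)
  · -- Group 2: far boxes, exponential Markov bound, factorisation, Hoeffding's lemma
    have hfar : ∀ J ∈ B.filter (fun J => ¬ ∑ i, J i ≤ mstar),
        ∫ t in maynardSimplex n, ∏ i, cellFn φ h (J i) (t i) ≤
          Real.exp (s * δ₀) * ∏ i, ∫ x, cellFn φ h (J i) x * Real.exp (-s * roundErr h x) := by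
      intro J hJ
      rw [Finset.mem_filter, not_le] at hJ
      have hJ' : mstar + 1 ≤ ∑ i, J i := hJ.2
      calc ∫ t in maynardSimplex n, ∏ i, cellFn φ h (J i) (t i)
          ≤ ∫ t in maynardSimplex n, Real.exp (s * δ₀) *
              ∏ i, (cellFn φ h (J i) (t i) * Real.exp (-s * roundErr h (t i))) := by
            refine setIntegral_mono_on (integrable_boxTerm hφ h J).integrableOn
              ((integrable_boxTerm_tilt hφ hh s J).const_mul _).integrableOn
              (measurableSet_maynardSimplex n) fun t ht => ?_
            exact boxTerm_le_exp_mul hφ0 hh hs0 hJ' ht.2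
        _ ≤ ∫ t : Fin n → ℝ, Real.exp (s * δ₀) *
              ∏ i, (cellFn φ h (J i) (t i) * Real.exp (-s * roundErr h (t i))) := by
            refine setIntegral_le_integral ((integrable_boxTerm_tilt hφ hh s J).const_mul _)
              (Filter.Eventually.of_forall fun t => mul_nonneg (Real.exp_pos _).le
                (Finset.prod_nonneg fun i _ => mul_nonneg (cellFn_nonneg hφ0 h _ _) (Real.exp_pos _).le))
        _ = Real.exp (s * δ₀) * ∏ i, ∫ x, cellFn φ h (J i) x * Real.exp (-s * roundErr h x) := by
            rw [integral_const_mul, integral_boxTerm_tilt]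
    set q : ℕ → ℝ := fun j => ∫ x, cellFn φ h j x * Real.exp (-s * roundErr h x) with hq
    have hq0 : ∀ j, 0 ≤ q j := fun j =>
      integral_nonneg fun x => mul_nonneg (cellFn_nonneg hφ0 h _ _) (Real.exp_pos _).le
    -- Σ over far boxes ≤ Σ over all boxes = e^{sδ₀} (Σ_j q_j)^n
    have hQ : ∑ j ∈ range Jc, q j = ∫ x in Ici 0, Real.exp (-s * roundErr h x) * φ x :=
      sum_integral_cellFn_mul_exp hφ hh hT hJc s
    have hQ0 : 0 ≤ ∑ j ∈ range Jc, q j := Finset.sum_nonneg fun j _ => hq0 j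
    -- Hoeffding's lemma: `∫ e^{−s r} φ ≤ m₀ e^{−sE + s²h²/8}`
    have hHL : ∫ x in Ici 0, Real.exp (-s * roundErr h x) * φ x ≤
        m₀ * Real.exp (-s * E + s ^ 2 * h ^ 2 / 8) := by
      have h1 := integral_exp_mul_roundErr_le hφ hφ0 hT hh hm₀ hm₀pos (-s)
      have h2 : ∫ x in Ici 0, Real.exp (-s * roundErr h x) * φ x =
          Real.exp (-s * E) * ∫ x in Ici 0, Real.exp (-s * (roundErr h x - E)) * φ x := by
        rw [← integral_const_mul]
        refine setIntegral_congr_fun measurableSet_Ici fun x _ => ?_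
        rw [← mul_assoc, ← Real.exp_add]
        congr 1; congr 1; ring
      rw [h2, Real.exp_add (-s * E), mul_comm m₀, mul_assoc]
      refine mul_le_mul_of_nonneg_left ?_ (Real.exp_pos _).le
      calc ∫ x in Ici 0, Real.exp (-s * (roundErr h x - E)) * φ x ≤ m₀ * Real.exp ((-s) ^ 2 * h ^ 2 / 8) := h1
        _ = Real.exp (s ^ 2 * h ^ 2 / 8) * m₀ := by rw [mul_comm]; congr 2; ring
    calc ∑ J ∈ B.filter (fun J => ¬ ∑ i, J i ≤ mstar), ∫ t in maynardSimplex n, ∏ i, cellFn φ h (J i) (t i)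
        ≤ ∑ J ∈ B.filter (fun J => ¬ ∑ i, J i ≤ mstar), Real.exp (s * δ₀) * ∏ i, q (J i) :=
          Finset.sum_le_sum hfar
      _ ≤ ∑ J ∈ B, Real.exp (s * δ₀) * ∏ i, q (J i) :=
          Finset.sum_le_sum_of_subset_of_nonneg (Finset.filter_subset _ _) fun J _ _ =>
            mul_nonneg (Real.exp_pos _).le (Finset.prod_nonneg fun i _ => hq0 _)
      _ = Real.exp (s * δ₀) * (∑ j ∈ range Jc, q j) ^ n := by
          rw [← Finset.mul_sum, Finset.sum_prod_piFinset, Finset.prod_const, Finset.card_univ,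
            Fintype.card_fin]
      _ ≤ Real.exp (s * δ₀) * (m₀ * Real.exp (-s * E + s ^ 2 * h ^ 2 / 8)) ^ n := by
          refine mul_le_mul_of_nonneg_left ?_ (Real.exp_pos _).le
          exact pow_le_pow_left₀ hQ0 (hQ.le.trans hHL) n
      _ = m₀ ^ n * Real.exp (s * δ₀ + n * (-s * E + s ^ 2 * h ^ 2 / 8)) := by
          rw [mul_pow, ← Real.exp_nat_mul, Real.exp_add]; ring
      _ ≤ m₀ ^ n * Real.exp (-2 * lam ^ 2 / (n * h ^ 2)) := by
          refine mul_le_mul_of_nonneg_left (Real.exp_le_exp.2 ?_) (pow_nonneg hm₀pos.le n)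
          -- `s δ₀ − n s E ≤ −s λ` and `−sλ + n s² h²/8 = −2λ²/(n h²)` for `s = 4λ/(n h²)`
          have h1 : s * δ₀ - n * (s * E) ≤ -(s * lam) := by
            have : δ₀ + lam ≤ n * E := hcond
            nlinarith
          have h2 : -(s * lam) + n * (s ^ 2 * h ^ 2 / 8) = -2 * lam ^ 2 / (n * h ^ 2) := by
            rw [hs]; field_simp; ring
          nlinarith

/-- **The same bound for the convolution power** (`n+1 ≥ 1` factors):
`∫_{(0,1]} φ^{⋆(n+1)} ≤ Σ_{m ≤ m⋆} (p^{∗(n+1)})_m + m₀^{n+1} e^{−2λ²/((n+1)h²)}` whenever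
`1 − (m⋆+1)h + λ ≤ (n+1) e` — Hoeffding-recentred form of `setIntegral_cpow_le_sum_dconvPow`. [cite: Hoeffding1963, Thm 2] -/
theorem setIntegral_cpow_le_hoeffding (hφ : LocBdd φ) (hφ0 : ∀ x, 0 ≤ φ x)
    (hT : ∀ x, T < x → φ x = 0) (hh : 0 < h) (hJc : T < (Jc : ℝ) * h) (n mstar : ℕ)
    {lam : ℝ} (hlam : 0 ≤ lam) {m₀ : ℝ} (hm₀ : m₀ = ∫ x in Ici 0, φ x) (hm₀pos : 0 < m₀)
    (hcond : (1 - ((mstar : ℝ) + 1) * h) + lam ≤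
      (n + 1 : ℝ) * ((∫ x in Ici 0, roundErr h x * φ x) / m₀)) :
    ∫ x in Ioc 0 1, cpow φ (n + 1) x ≤
      ∑ m ∈ range (mstar + 1), dconvPow (cellMass φ h) (n + 1) m +
        m₀ ^ (n + 1) * Real.exp (-2 * lam ^ 2 / ((n + 1 : ℝ) * h ^ 2)) := by
  have h1 := setIntegral_simplex_sum_prod_eq_cpow n hφ (Φ := fun _ => (1:ℝ)) measurable_const (B := 1)
    (fun w _ => by simp)
  simp only [one_mul] at h1
  rw [← h1]
  have h2 := setIntegral_simplex_prod_le_hoeffding hφ hφ0 hT hh hJc (n := n + 1) (by omega) mstar hlam hm₀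
    hm₀pos (by push_cast; exact hcond)
  push_cast at h2
  exact h2

end Main

/-! ### The Hoeffding-recentred numerator (lower) bound -/

section Lower

variable {φ : ℝ → ℝ} {h T : ℝ} {Jc n : ℕ}

/-- With `p` vanishing beyond `J_c` the box sum IS the convolution power:
`(p^{∗n})_m = Σ_{J ∈ [0,J_c)^n, |J| = m} ∏ p_{Jᵢ}`. [cite: GathenGerhard2013ModernComputerAlgebra, §2.3 (4)] -/
theorem sum_box_fiber_eq_dconvPow {p : ℕ → ℝ} (hpJ : ∀ j, Jc ≤ j → p j = 0) (n m : ℕ) :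
    ∑ J ∈ (Fintype.piFinset (fun _ : Fin n => range Jc)).filter (fun J => ∑ i, J i = m), ∏ i, p (J i) =
      dconvPow p n m := by
  classical
  set S := (Fintype.piFinset (fun _ : Fin n => range Jc)).filter (fun J => ∑ i, J i = m) with hS
  have hpow : (PowerSeries.mk p) ^ n = ∏ _i : Fin n, PowerSeries.mk p := by
    rw [Finset.prod_const, Finset.card_univ, Fintype.card_fin]
  rw [dconvPow, hpow, PowerSeries.coeff_prod]
  simp only [PowerSeries.coeff_mk]
  set e : (Fin n → ℕ) → (Fin n →₀ ℕ) := fun J => Finsupp.equivFunOnFinite.symm J with he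
  have hinj : Set.InjOn e S := fun a _ b _ hab => Finsupp.equivFunOnFinite.symm.injective hab
  have h1 : ∑ J ∈ S, ∏ i, p (J i) = ∑ l ∈ S.image e, ∏ i, p (l i) := by
    rw [Finset.sum_image hinj]
    rfl
  rw [h1]
  refine Finset.sum_subset ?_ ?_
  · intro l hl
    obtain ⟨J, hJ, rfl⟩ := Finset.mem_image.1 hl
    rw [hS, Finset.mem_filter] at hJ
    rw [Finset.mem_finsuppAntidiag]
    refine ⟨?_, fun i _ => Finset.mem_univ i⟩
    simpa [he] using hJ.2
  · intro l hl hlS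
    rw [Finset.mem_finsuppAntidiag] at hl
    -- `l` (as a function) is not in the box: some coordinate is `≥ J_c`
    have hnot : ¬ (∀ i, (l i) < Jc) := by
      intro hall
      apply hlS
      refine Finset.mem_image.2 ⟨fun i => l i, ?_, ?_⟩
      · rw [hS, Finset.mem_filter, Fintype.mem_piFinset]
        exact ⟨fun i => Finset.mem_range.2 (hall i), by simpa using hl.1⟩
      · simp [he]
    push Not at hnot
    obtain ⟨i, hi⟩ := hnot
    exact Finset.prod_eq_zero (Finset.mem_univ i) (hpJ _ hi)

/-- Cells beyond the support carry no mass: `T ≤ jh ⟹ p_j = 0`. [cite: KlugmanPanjerWillmot2004, §6.6.5.1 (method of rounding)] -/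
theorem cellMass_eq_zero_of_le (hT : ∀ x, T < x → φ x = 0) {h : ℝ} {j : ℕ}
    (hj : T ≤ (j : ℝ) * h) : cellMass φ h j = 0 := by
  rw [cellMass]
  refine (setIntegral_congr_fun measurableSet_Ioc (g := fun _ => (0:ℝ)) fun t ht => ?_).trans (by simp)
  exact hT t (lt_of_le_of_lt hj ht.1)

/-- The extension by zero `φ₊ = 𝟙_{[0,∞)}φ` decomposes over the cells (all real `x`).
[cite: KlugmanPanjerWillmot2004, §6.6.5.1 (method of rounding)] -/
theorem posPart'_eq_sum_cellFn (hh : 0 < h) (hT : ∀ x, T < x → φ x = 0) (hJc : T < (Jc : ℝ) * h) (x : ℝ) :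
    posPart' φ x = ∑ j ∈ range Jc, cellFn φ h j x := by
  have hvan : ∀ x, (Jc : ℝ) * h ≤ x → φ x = 0 := fun x hx => hT x (lt_of_lt_of_le hJc hx)
  by_cases hx : 0 ≤ x
  · rw [posPart', indicator_of_mem (show x ∈ Ici (0:ℝ) from hx)]
    exact (sum_indicator_Ico_eq hh hvan hx).symm
  · rw [posPart', indicator_of_notMem (show x ∉ Ici (0:ℝ) from hx)]
    refine (Finset.sum_eq_zero fun j _ => ?_).symm
    rw [cellFn, indicator_of_notMem]
    intro hxj
    exact hx (le_trans (by positivity) hxj.1)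

/-- **Pointwise lower bound on a box** (rounding UP, recentred): for an antitone weight `0 ≤ Ψ ≤ B`, `s ≥ 0` and any
`δ`, on the box `J` one has
`Ψ(Σtᵢ) ∏cᵢ ≥ Ψ(h(|J|+n) − δ) ∏cᵢ − B e^{s(δ − nh)} ∏ cᵢ e^{s r_h(tᵢ)}` (`cᵢ = (𝟙_{C_{Jᵢ}}φ)(tᵢ)`): either the
upward rounding error `R' = Σ(h − r_h(tᵢ)) ≥ δ`, and then `Σtᵢ ≤ h(|J|+n) − δ`, or `e^{s(δ−R')} ≥ 1`.
[cite: Hoeffding1963, Thm 2 (proof)] -/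
theorem weight_boxTerm_ge (hφ0 : ∀ x, 0 ≤ φ x) (hh : 0 < h) {Ψ : ℝ → ℝ} (hΨ : Antitone Ψ)
    (hΨ0 : ∀ x, 0 ≤ Ψ x) {B : ℝ} (hΨB : ∀ x, Ψ x ≤ B) {s : ℝ} (hs : 0 ≤ s) (δ : ℝ)
    (J : Fin n → ℕ) (t : Fin n → ℝ) :
    Ψ ((((∑ i, J i : ℕ) : ℝ) + n) * h - δ) * ∏ i, cellFn φ h (J i) (t i) -
        B * Real.exp (s * (δ - n * h)) * ∏ i, (cellFn φ h (J i) (t i) * Real.exp (-(-s) * roundErr h (t i))) ≤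
      Ψ (∑ i, t i) * ∏ i, cellFn φ h (J i) (t i) := by
  have hB0 : 0 ≤ B := (hΨ0 0).trans (hΨB 0)
  have hG0 : 0 ≤ ∏ i, cellFn φ h (J i) (t i) := Finset.prod_nonneg fun i _ => cellFn_nonneg hφ0 h _ _
  have htilt : ∏ i, (cellFn φ h (J i) (t i) * Real.exp (-(-s) * roundErr h (t i))) =
      (∏ i, cellFn φ h (J i) (t i)) * Real.exp (s * ∑ i, roundErr h (t i)) := by
    rw [Finset.prod_mul_distrib, ← Real.exp_sum, Finset.mul_sum]
    simp only [neg_neg]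
  rw [htilt]
  by_cases hzero : ∏ i, cellFn φ h (J i) (t i) = 0
  · rw [hzero]; simp
  have hGpos : 0 < ∏ i, cellFn φ h (J i) (t i) := lt_of_le_of_ne hG0 (Ne.symm hzero)
  have hmem : ∀ i, t i ∈ Ico ((J i : ℝ) * h) (((J i : ℝ) + 1) * h) := by
    intro i
    by_contra hni
    apply hzero
    exact Finset.prod_eq_zero (Finset.mem_univ i) (by rw [cellFn, indicator_of_notMem hni])
  have hr : ∀ i, roundErr h (t i) = t i - (J i : ℝ) * h := fun i => roundErr_of_mem_Ico hh (hmem i)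
  have hsumr : ∑ i, roundErr h (t i) = ∑ i, t i - (∑ i, J i : ℕ) * h := by
    simp_rw [hr]
    rw [Finset.sum_sub_distrib, Nat.cast_sum, Finset.sum_mul]
  -- `R' = n h − Σ r`, and `Σ t = h(|J| + n) − R'`
  by_cases hR : δ ≤ n * h - ∑ i, roundErr h (t i)
  · -- then `Σ t ≤ h(|J|+n) − δ`
    have hle : ∑ i, t i ≤ (((∑ i, J i : ℕ) : ℝ) + n) * h - δ := by rw [hsumr] at hR; linarith
    have h1 : Ψ ((((∑ i, J i : ℕ) : ℝ) + n) * h - δ) ≤ Ψ (∑ i, t i) := hΨ hle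
    have h2 : 0 ≤ B * Real.exp (s * (δ - n * h)) *
        ((∏ i, cellFn φ h (J i) (t i)) * Real.exp (s * ∑ i, roundErr h (t i))) := by positivity
    nlinarith
  · -- then `e^{s(δ − R')} ≥ 1`, so the subtracted term dominates `B ∏ c ≥ Ψ ∏ c`
    have hlt : n * h - ∑ i, roundErr h (t i) < δ := not_le.1 hR
    have hexp : 1 ≤ Real.exp (s * (δ - n * h)) * Real.exp (s * ∑ i, roundErr h (t i)) := by
      rw [← Real.exp_add]
      exact Real.one_le_exp (by nlinarith)
    have h3 : Ψ ((((∑ i, J i : ℕ) : ℝ) + n) * h - δ) * ∏ i, cellFn φ h (J i) (t i) ≤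
        B * Real.exp (s * (δ - n * h)) *
          ((∏ i, cellFn φ h (J i) (t i)) * Real.exp (s * ∑ i, roundErr h (t i))) := by
      calc Ψ ((((∑ i, J i : ℕ) : ℝ) + n) * h - δ) * ∏ i, cellFn φ h (J i) (t i)
          ≤ B * ∏ i, cellFn φ h (J i) (t i) := mul_le_mul_of_nonneg_right (hΨB _) hG0
        _ = (B * ∏ i, cellFn φ h (J i) (t i)) * 1 := (mul_one _).symm
        _ ≤ (B * ∏ i, cellFn φ h (J i) (t i)) *
              (Real.exp (s * (δ - n * h)) * Real.exp (s * ∑ i, roundErr h (t i))) :=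
            mul_le_mul_of_nonneg_left hexp (mul_nonneg hB0 hG0)
        _ = _ := by ring
    have h4 : 0 ≤ Ψ (∑ i, t i) * ∏ i, cellFn φ h (J i) (t i) := mul_nonneg (hΨ0 _) hG0
    linarith

/-- **Hoeffding-recentred lower lattice bound** (rounding every factor UP, recentred by the mean upward error
`e' = h − e`): for `φ ≥ 0` locally bounded vanishing beyond `T < J_c h`, an antitone weight `0 ≤ Ψ ≤ B` with `Ψ(1) = 0`,
`n ≥ 1`, any `M`, `δ` and `λ ≥ 0` with `δ + λ ≤ n (h − e)`:
`Σ_{m<M} Ψ((m+n)h − δ) (p^{∗n})_m − B m₀^n e^{−2λ²/(nh²)} ≤ ∫_{R_n} Ψ(Σtᵢ) ∏ φ(tᵢ) dt`, i.e.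
`E Ψ(S) ≥ E Ψ(S⁺ − δ) − B e^{−2λ²/(nh²)}`. [cite: Hoeffding1963, Thm 2] -/
theorem sum_weight_dconvPow_le_setIntegral_simplex_hoeffding (hφ : LocBdd φ) (hφ0 : ∀ x, 0 ≤ φ x)
    (hT : ∀ x, T < x → φ x = 0) (hh : 0 < h) (hJc : T < (Jc : ℝ) * h) (hn : 1 ≤ n)
    {Ψ : ℝ → ℝ} (hΨ : Antitone Ψ) (hΨ0 : ∀ x, 0 ≤ Ψ x) {B : ℝ} (hΨB : ∀ x, Ψ x ≤ B) (hΨ1 : Ψ 1 = 0)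
    (M : ℕ) (δ : ℝ) {lam : ℝ} (hlam : 0 ≤ lam) {m₀ : ℝ} (hm₀ : m₀ = ∫ x in Ici 0, φ x)
    (hm₀pos : 0 < m₀)
    (hcond : δ + lam ≤ n * (h - (∫ x in Ici 0, roundErr h x * φ x) / m₀)) :
    ∑ m ∈ range M, Ψ ((((m + n : ℕ) : ℝ)) * h - δ) * dconvPow (cellMass φ h) n m -
        B * (m₀ ^ n * Real.exp (-2 * lam ^ 2 / (n * h ^ 2))) ≤
      ∫ t in maynardSimplex n, Ψ (∑ i, t i) * ∏ i, φ (t i) := by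
  classical
  set Bx := Fintype.piFinset (fun _ : Fin n => range Jc) with hBx
  set p := cellMass φ h with hp
  have hp0 : ∀ j, 0 ≤ p j := cellMass_nonneg hφ0 h
  have hpJ : ∀ j, Jc ≤ j → p j = 0 := fun j hj =>
    cellMass_eq_zero_of_le hT (hJc.le.trans (mul_le_mul_of_nonneg_right (by exact_mod_cast hj) hh.le))
  set E : ℝ := (∫ x in Ici 0, roundErr h x * φ x) / m₀ with hE
  set s : ℝ := 4 * lam / (n * h ^ 2) with hs
  have hn0 : (0:ℝ) < n := by exact_mod_cast hn
  have hs0 : 0 ≤ s := by rw [hs]; positivity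
  have hB0 : 0 ≤ B := (hΨ0 0).trans (hΨB 0)
  have hΨm : Measurable Ψ := hΨ.measurable
  have hΨge1 : ∀ x, 1 ≤ x → Ψ x = 0 := fun x hx => le_antisymm (hΨ1 ▸ hΨ hx) (hΨ0 x)
  -- Step 1: the simplex integral as a whole-space integral of `Ψ(Σt) ∏ φ₊(tᵢ)`
  have hwhole : ∫ t in maynardSimplex n, Ψ (∑ i, t i) * ∏ i, φ (t i) =
      ∫ t : Fin n → ℝ, Ψ (∑ i, t i) * ∏ i, posPart' φ (t i) := by
    have h1 : ∫ t in maynardSimplex n, Ψ (∑ i, t i) * ∏ i, φ (t i) =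
        ∫ t in maynardSimplex n, Ψ (∑ i, t i) * ∏ i, posPart' φ (t i) := by
      refine setIntegral_congr_fun (measurableSet_maynardSimplex n) fun t ht => ?_
      congr 1
      exact Finset.prod_congr rfl fun i _ => by
        rw [posPart', indicator_of_mem (show t i ∈ Ici (0:ℝ) from ht.1 i)]
    rw [h1]
    refine setIntegral_eq_integral_of_forall_compl_eq_zero fun t ht => ?_
    by_cases hneg : ∃ i, t i < 0
    · obtain ⟨i, hi⟩ := hneg
      rw [Finset.prod_eq_zero (Finset.mem_univ i) (by
        rw [posPart', indicator_of_notMem (show t i ∉ Ici (0:ℝ) from not_le.2 hi)]), mul_zero]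
    · push Not at hneg
      have hsum : 1 < ∑ i, t i := by
        by_contra hle
        exact ht ⟨hneg, not_lt.1 hle⟩
      rw [hΨge1 _ hsum.le, zero_mul]
  -- Step 2: box decomposition of the integrand, integrate termwise
  have hbd : ∀ t : Fin n → ℝ, ‖Ψ (∑ i, t i)‖ ≤ B := fun t => by
    rw [Real.norm_eq_abs, abs_of_nonneg (hΨ0 _)]; exact hΨB _
  have hint_box : ∀ J : Fin n → ℕ,
      Integrable (fun t : Fin n → ℝ => Ψ (∑ i, t i) * ∏ i, cellFn φ h (J i) (t i)) := fun J =>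
    (integrable_boxTerm hφ h J).bdd_mul
      ((hΨm.comp (Finset.measurable_sum _ fun i _ => measurable_pi_apply i)).aestronglyMeasurable)
      (ae_of_all _ hbd)
  have hdecomp : ∫ t : Fin n → ℝ, Ψ (∑ i, t i) * ∏ i, posPart' φ (t i) =
      ∑ J ∈ Bx, ∫ t : Fin n → ℝ, Ψ (∑ i, t i) * ∏ i, cellFn φ h (J i) (t i) := by
    rw [← integral_finsetSum _ fun J _ => hint_box J]
    congr 1; funext t
    rw [← Finset.mul_sum]
    congr 1
    rw [← Finset.prod_univ_sum (fun _ : Fin n => range Jc) (fun i j => cellFn φ h j (t i))]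
    exact Finset.prod_congr rfl fun i _ => posPart'_eq_sum_cellFn hh hT hJc (t i)
  rw [hwhole, hdecomp]
  -- Step 3: per-box lower bound, integrated
  set q : ℕ → ℝ := fun j => ∫ x, cellFn φ h j x * Real.exp (-(-s) * roundErr h x) with hq
  have hq0 : ∀ j, 0 ≤ q j := fun j =>
    integral_nonneg fun x => mul_nonneg (cellFn_nonneg hφ0 h _ _) (Real.exp_pos _).le
  have hbox : ∀ J ∈ Bx,
      Ψ ((((∑ i, J i : ℕ) : ℝ) + n) * h - δ) * ∏ i, p (J i) -
          B * Real.exp (s * (δ - n * h)) * ∏ i, q (J i) ≤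
        ∫ t : Fin n → ℝ, Ψ (∑ i, t i) * ∏ i, cellFn φ h (J i) (t i) := by
    intro J _
    have h1 : ∫ t : Fin n → ℝ, (Ψ ((((∑ i, J i : ℕ) : ℝ) + n) * h - δ) * ∏ i, cellFn φ h (J i) (t i) -
        B * Real.exp (s * (δ - n * h)) * ∏ i, (cellFn φ h (J i) (t i) * Real.exp (-(-s) * roundErr h (t i)))) =
        Ψ ((((∑ i, J i : ℕ) : ℝ) + n) * h - δ) * ∏ i, p (J i) -
          B * Real.exp (s * (δ - n * h)) * ∏ i, q (J i) := by
      rw [integral_sub ((integrable_boxTerm hφ h J).const_mul _)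
        ((integrable_boxTerm_tilt hφ hh (-s) J).const_mul _), integral_const_mul, integral_const_mul,
        integral_boxTerm, integral_boxTerm_tilt]
    rw [← h1]
    exact integral_mono (((integrable_boxTerm hφ h J).const_mul _).sub
      ((integrable_boxTerm_tilt hφ hh (-s) J).const_mul _)) (hint_box J)
      fun t => weight_boxTerm_ge hφ0 hh hΨ hΨ0 hΨB hs0 δ J t
  have hsum_box : ∑ J ∈ Bx, (Ψ ((((∑ i, J i : ℕ) : ℝ) + n) * h - δ) * ∏ i, p (J i)) -
      B * Real.exp (s * (δ - n * h)) * (∑ j ∈ range Jc, q j) ^ n ≤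
        ∑ J ∈ Bx, ∫ t : Fin n → ℝ, Ψ (∑ i, t i) * ∏ i, cellFn φ h (J i) (t i) := by
    have h1 : B * Real.exp (s * (δ - n * h)) * (∑ j ∈ range Jc, q j) ^ n =
        ∑ J ∈ Bx, B * Real.exp (s * (δ - n * h)) * ∏ i, q (J i) := by
      rw [← Finset.mul_sum, Finset.sum_prod_piFinset, Finset.prod_const, Finset.card_univ, Fintype.card_fin]
    rw [h1, ← Finset.sum_sub_distrib]
    exact Finset.sum_le_sum hbox
  -- Step 4: the error term via Hoeffding's lemma (tilt `+s`: the upward errors `h − r_h`)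
  have hQ : ∑ j ∈ range Jc, q j = ∫ x in Ici 0, Real.exp (-(-s) * roundErr h x) * φ x :=
    sum_integral_cellFn_mul_exp hφ hh hT hJc (-s)
  have hQ0 : 0 ≤ ∑ j ∈ range Jc, q j := Finset.sum_nonneg fun j _ => hq0 j
  have hHL : ∫ x in Ici 0, Real.exp (-(-s) * roundErr h x) * φ x ≤
      m₀ * Real.exp (s * E + s ^ 2 * h ^ 2 / 8) := by
    have h1 := integral_exp_mul_roundErr_le hφ hφ0 hT hh hm₀ hm₀pos s
    have h2 : ∫ x in Ici 0, Real.exp (-(-s) * roundErr h x) * φ x =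
        Real.exp (s * E) * ∫ x in Ici 0, Real.exp (s * (roundErr h x - E)) * φ x := by
      rw [← integral_const_mul]
      refine setIntegral_congr_fun measurableSet_Ici fun x _ => ?_
      rw [← mul_assoc, ← Real.exp_add]
      congr 1; congr 1; ring
    rw [h2, Real.exp_add (s * E), mul_comm m₀, mul_assoc]
    refine mul_le_mul_of_nonneg_left ?_ (Real.exp_pos _).le
    rw [mul_comm]; exact h1
  have herr : B * Real.exp (s * (δ - n * h)) * (∑ j ∈ range Jc, q j) ^ n ≤
      B * (m₀ ^ n * Real.exp (-2 * lam ^ 2 / (n * h ^ 2))) := by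
    calc B * Real.exp (s * (δ - n * h)) * (∑ j ∈ range Jc, q j) ^ n
        ≤ B * Real.exp (s * (δ - n * h)) * (m₀ * Real.exp (s * E + s ^ 2 * h ^ 2 / 8)) ^ n := by
          refine mul_le_mul_of_nonneg_left (pow_le_pow_left₀ hQ0 (hQ.le.trans hHL) n) (by positivity)
      _ = B * (m₀ ^ n * Real.exp (s * (δ - n * h) + n * (s * E + s ^ 2 * h ^ 2 / 8))) := by
          rw [mul_pow, ← Real.exp_nat_mul, Real.exp_add (s * (δ - n * h))]; ring
      _ ≤ B * (m₀ ^ n * Real.exp (-2 * lam ^ 2 / (n * h ^ 2))) := by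
          refine mul_le_mul_of_nonneg_left (mul_le_mul_of_nonneg_left (Real.exp_le_exp.2 ?_)
            (pow_nonneg hm₀pos.le n)) hB0
          have h1 : s * (δ - n * h) + n * (s * E) ≤ -(s * lam) := by
            have : δ + lam ≤ n * (h - E) := hcond
            nlinarith
          have h2 : -(s * lam) + n * (s ^ 2 * h ^ 2 / 8) = -2 * lam ^ 2 / (n * h ^ 2) := by
            rw [hs]; field_simp; ring
          nlinarith
  -- Step 5: the main lattice sum, fibrewise = convolution powers; truncate to `m < M`
  have hmain : ∑ m ∈ range M, Ψ (((m + n : ℕ) : ℝ) * h - δ) * dconvPow p n m ≤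
      ∑ J ∈ Bx, Ψ ((((∑ i, J i : ℕ) : ℝ) + n) * h - δ) * ∏ i, p (J i) := by
    have hfib : ∀ m, Ψ (((m + n : ℕ) : ℝ) * h - δ) * dconvPow p n m =
        ∑ J ∈ Bx.filter (fun J => ∑ i, J i = m), Ψ ((((∑ i, J i : ℕ) : ℝ) + n) * h - δ) * ∏ i, p (J i) := by
      intro m
      rw [← sum_box_fiber_eq_dconvPow hpJ n m, Finset.mul_sum]
      refine Finset.sum_congr rfl fun J hJ => ?_
      rw [Finset.mem_filter] at hJ
      rw [hJ.2]; push_cast; ring_nf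
    simp_rw [hfib]
    rw [← Finset.sum_biUnion]
    · refine Finset.sum_le_sum_of_subset_of_nonneg ?_ fun J _ _ =>
        mul_nonneg (hΨ0 _) (Finset.prod_nonneg fun i _ => hp0 _)
      intro J hJ
      obtain ⟨m, -, hm⟩ := Finset.mem_biUnion.1 hJ
      exact (Finset.mem_filter.1 hm).1
    · intro m _ m' _ hmm'
      simp only [Function.onFun]
      rw [Finset.disjoint_left]
      intro J h1 h2
      rw [Finset.mem_filter] at h1 h2
      exact hmm' (h1.2.symm.trans h2.2)
  linarith [hmain, hsum_box, herr]

/-- **The same bound for the convolution power** (`n+1 ≥ 1` factors), Hoeffding-recentred form of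
`sum_shift_mul_dconvPow_le_setIntegral`: for an antitone weight `0 ≤ Ψ ≤ B` with `Ψ(1) = 0`, bounded measurable on `[0,1]`,
`Σ_{m<M} Ψ((m+n+1)h − δ) (p^{∗(n+1)})_m − B m₀^{n+1} e^{−2λ²/((n+1)h²)} ≤ ∫_{(0,1]} Ψ φ^{⋆(n+1)}` whenever
`δ + λ ≤ (n+1)(h − e)`. [cite: Hoeffding1963, Thm 2] -/
theorem sum_weight_dconvPow_le_setIntegral_cpow_hoeffding (hφ : LocBdd φ) (hφ0 : ∀ x, 0 ≤ φ x)
    (hT : ∀ x, T < x → φ x = 0) (hh : 0 < h) (hJc : T < (Jc : ℝ) * h) (n : ℕ)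
    {Ψ : ℝ → ℝ} (hΨ : Antitone Ψ) (hΨ0 : ∀ x, 0 ≤ Ψ x) {B : ℝ} (hΨB : ∀ x, Ψ x ≤ B) (hΨ1 : Ψ 1 = 0)
    (M : ℕ) (δ : ℝ) {lam : ℝ} (hlam : 0 ≤ lam) {m₀ : ℝ} (hm₀ : m₀ = ∫ x in Ici 0, φ x)
    (hm₀pos : 0 < m₀)
    (hcond : δ + lam ≤ (n + 1 : ℝ) * (h - (∫ x in Ici 0, roundErr h x * φ x) / m₀)) :
    ∑ m ∈ range M, Ψ ((((m + (n + 1) : ℕ) : ℝ)) * h - δ) * dconvPow (cellMass φ h) (n + 1) m -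
        B * (m₀ ^ (n + 1) * Real.exp (-2 * lam ^ 2 / ((n + 1 : ℝ) * h ^ 2))) ≤
      ∫ x in Ioc 0 1, Ψ x * cpow φ (n + 1) x := by
  have hB0 : 0 ≤ B := (hΨ0 0).trans (hΨB 0)
  have h1 := setIntegral_simplex_sum_prod_eq_cpow n hφ (Φ := Ψ) hΨ.measurable (B := B)
    (fun w _ => by rw [abs_of_nonneg (hΨ0 w)]; exact hΨB w)
  rw [← h1]
  have h2 := sum_weight_dconvPow_le_setIntegral_simplex_hoeffding hφ hφ0 hT hh hJc (n := n + 1) (by omega)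
    hΨ hΨ0 hΨB hΨ1 M δ hlam hm₀ hm₀pos (by push_cast; exact hcond)
  push_cast at h2 ⊢
  exact h2

end Lower

end MaynardTao

end Literature.NumberTheory.Sieve
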